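import Literature.AlgebraicGeometry.HodgeTheory.WeilClassesSixfolds
import Literature.AlgebraicGeometry.HodgeTheory.WeilClassesFourfolds
import HarnessLib

/-!
# Weil classes on abelian SIXFOLDS of split Weil type with `K = ℚ(√-3)` (Schoen 1998, every member of the universal family)

Family `hodge`, layer `Literature/AlgebraicGeometry/HodgeTheory`. The CLASSICAL, REFEREED sixfold case of the
Hodge–Weil problem, typed as the `d = 3` slice of the floor fact `Markman2025_weilClasses_algebraic_hyperbolicSixfold`
(arXiv:2502.03415 Thm. 1.5.1, an unrefereed preprint: all `K`, discriminant `(-1)³`), with that fact's rendering of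
"split / discriminant `(-1)ⁿ`" as `Motives.IsHyperbolicWeilType A φ 3 h` reused VERBATIM — so no new definition.
Requested by the B2b ladder `hodge-weil` (packet `run/shared/lean/b2b/hodge-weil/`): it gives the floor F0a a refereed
trust base at `K = ℚ(√-3)`, for ALL (not only general) members. Companion of
`WeilClassesFourfoldsDiscOneSchoen.lean` (the fourfold case, Schoen 1988 / van Geemen 4.15).

Source READ (held, `paper:doi-10-1023-a-1000566205021`): C. Schoen, *Addendum to: Hodge classes on self-products of
a variety with an automorphism*, Compositio Math. 114 (1998) 329–336 [`Schoen1998HodgeWeilAddendum`; refereed],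
verbatim:

> (p. 330) "The proof of the theorem proceeds in three steps. First, the theory of moduli of Abelian varieties of
> Weil type is recalled with special emphasis on the polarization invariant. Next the Hodge conjecture for the Weil
> cohomology of infinitely many families of Weil type Abelian 4-folds is deduced from the assumption that the Hodge
> conjecture holds for a single family of Weil type Abelian 6-folds. Finally the Hodge conjecture for a family of
> Weil type Abelian 6-folds is proved using the methods of [Sch, Sect. 3]."
> (§11–12, p. 334) "(3) there is a finite étale morphism `C → X`, which is Galois with group `ℤ/3` and whose fibers
> over closed points `m ∈ N` are (irreducible) genus 10 curves. Recall that the generalized Prym, `B`, for `C/X` is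
> defined to be the connected component of the identity in the kernel of the norm map … Thus `B` is a family of
> Abelian varieties of Weil type. The Weil cohomology of each fiber is generated by classes of codimension 3
> algebraic cycles [Sch, 3.1]. 12. Associated to the integral homology of this family is a Weil pair `(V_ℤ, ψ)` of
> rank 6. The invariant is `(3, f)` for some `f ∈ ℚ^×/N_{K/ℚ}K^×` with `sign(f) = -1` [Sch, 1.6a]. … The
> holomorphic family of polarized Abelian varieties `Γ₁\V_ℤ\J × V_ℝ → Γ₁\J =: W` (12.1) is canonically a projective
> morphism [Chai, 2.4]. … there is a holomorphic period map `φ : N → W` such that `B` is pulled back from (12.1). …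
> **To show that the Weil cohomology of every fiber of the 'universal' family, (12.1) is generated by classes of
> algebraic cycles, we need only verify that `φ` is dominant and apply the specialization argument given in
> [Sch, p. 30]. 13. LEMMA. `φ` is dominant.**" (proof pp. 334–335).

So Schoen proves: the Weil cohomology of EVERY fibre of the universal family (12.1) of the rank-6 Weil pair of the
generalized Prym of an étale `ℤ/3`-cover `C₁₀ → C₄` is spanned by algebraic classes. That Weil pair is SPLIT — its
discriminant class is `(-1)³` (van Geemen LNM 1594 §7.3 writes "det H = 1": in his normal form §5.4 (5.4.1),
`H = a z̄₁w₁ + z̄₂w₂ + ⋯ + z̄ₙwₙ - (z̄ₙ₊₁wₙ₊₁ + ⋯ + z̄₂ₙw₂ₙ)` "with `det H = (-1)ⁿ a`", `a ∈ ℚ_{>0}`, this is the statement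
`a = 1`, i.e. `det H ≡ (-1)³·1 = -1 mod Nm ℚ(√-3)^×` — the SPLIT class `[(-1)ⁿ]` (Deligne 1982 Cor. 4.2; Markman
arXiv:2509.23403 §11.5; the cell key `Ring2.Hypotheses.splitDiscriminantClass 3 3` on the summit side); a Hermitian
form of signature `(3,3)` has `det H < 0`, so the literal reading "`det H = +1 ∈ ℚ`" is impossible and is NOT what the
tree asserts — no declaration below carries a determinant hypothesis, only `Motives.IsHyperbolicWeilType`;
Markman, arXiv:2502.03415 §1 p. 3: "[schoen] … abelian sixfolds with `K = ℚ[√-3]` and trivial discriminant"; B2b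
packet `b2b-hweil-pv3-g2/DISCRIMINANT-CORRECTION.md`: every Prym of an unramified cyclic cover is hyperbolic, with
two exact computations `det H = -1728 ≡ -1`) — and every abelian sixfold `(A, φ)` of HYPERBOLIC Weil type for
`ℚ(√-3)` is `K`-isogenous to a fibre of (12.1) (the `K`-Hermitian spaces are both hyperbolic of rank 6, hence
isometric: Landherr 1936; van Geemen 5.3–5.4; commensurable lattices give an isogeny, Milne §8 — VERBATIM the reach
clause (c) of the tree's `weilFamilyReach_hyperbolic`), and the algebraicity of the Weil plane is an isogeny
invariant (van Geemen Thm. 6.12 proof; tree: `WeilClassesIsogenyDescent`; Schoen p. 330: "One may use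
[vG, 4.11, 6.12] to deduce the assertion in the abstract from the theorem"). Hence the rendering below (all
hyperbolic `ℚ(√-3)`-sixfolds) never asserts more than print.

## Rendering (identical conventions to `Markman2025_weilClasses_algebraic_hyperbolicSixfold`, at `d = 3`)

* `A : Motives.AbelianVariety ℂ`, `A.dim = 2 * 3`, smooth projective; `φ : A ⟶ A` with `φ ≫ φ = -(3 • 𝟙 A)`
  (`√-3 ∈ End(A)`; isogenous representatives always exist);
* the polarization through a projective embedding `e` and a rational `a ≠ 0` in `H²(ℙᴺ(ℂ); ℂ)`; "invariant `(3, f)`,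
  `f ≡ -1`" = "discriminant `(-1)³`" is `Motives.IsHyperbolicWeilType A φ 3 (3·e^*a + φ^*e^*a)`;
* "the Weil cohomology is generated by classes of algebraic cycles": every rational `(3,3)` class of the Weil plane
  `weilClassesOf A φ 3 3 = E₊ ⊔ E₋` (`= ⋀⁶ H¹_{ζ₃} ⊕ ⋀⁶ H¹_{ζ₃²} = U' ⊗ ℂ`, Schoen's `U'` of [Sch, p. 24]) lies in
  `algebraicClasses A.X 3`.

Upper bound: an instance of the summit statement (`…_of_hodgeConjectureFor`). Relation to the floor: it IS the `d = 3`
instance of `Markman2025_weilClasses_algebraic_hyperbolicSixfold` (`…_of_markman`), but REFEREED (1998). The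
mechanism "dominant ⟹ every fibre" (Schoen's "specialization argument [Sch, p. 30]") is kernel-checked in the tree as
`Summit.HodgeConjecture.HodgeConjecture.WeilTypeLadder.weilClasses_algebraic_of_prymOpen_family`
(`Theorems/WeilTypeLadderNonsplitSixfoldsSqrtMinus3.lean` — name a misnomer) from the per-cover fact
`Schoen1988_cyclicPrym_weilClasses_algebraic_degreeThree_genusFour` and the Baire lemma.

## References

* [Schoen1998HodgeWeilAddendum] C. Schoen, Compositio Math. 114 (1998) 329–336, Theorem (p. 329), §§11–13 (pp. 333–335).
* [Schoen1988HodgeWeil] C. Schoen, Compositio Math. 65 (1988) 3–32, §3 Cor. 3.1, p. 30 (specialization).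
* [vanGeemen1994HodgeAV] B. van Geemen, LNM 1594 (1994), 5.2–5.4, 6.12, 7.3.
* [Markman2025SecantWeil] E. Markman, arXiv:2502.03415, §1 p. 3 and Thm. 1.5.1.
-/

noncomputable section

open CategoryTheory

namespace Literature.AlgebraicGeometry.HodgeTheory

open Literature.AlgebraicTopology.SingularHomology

section HodgeTheory

/-- **Schoen 1998, §§11–13 (with Schoen 1988 Cor. 3.1 and p. 30): for EVERY six-dimensional abelian variety `(A, K)`
of SPLIT Weil type with `K = ℚ(√-3)` — every fibre of the universal family (12.1) of the Weil pair of the generalized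
Prym of an étale `ℤ/3`-cover `C₁₀ → C₄`, whose period map is dominant (Lemma 13) — the Weil cohomology is generated by
classes of codimension-3 algebraic cycles.** Rendering (module docstring): for `A` a smooth projective complex abelian
sixfold with `φ ≫ φ = -(3 • 𝟙 A)`, a projective embedding `e` and a rational `a ≠ 0` in `H²(ℙᴺ(ℂ); ℂ)` with `(A, φ)`
of HYPERBOLIC Weil type (discriminant `(-1)³`: Schoen's invariant `(3, f)`, `sign f = -1`, trivial class) for the
`K`-symmetrised hyperplane class `h = 3·e^*a + φ^*e^*a`, every rational `(3,3)` class of the Weil plane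
`weilClassesOf A φ 3 3` is algebraic (hyperbolic `(A, φ)` not literally a fibre of (12.1) are `K`-isogenous to one —
Landherr, van Geemen 5.3–5.4 — and algebraicity of the Weil plane is isogeny invariant, van Geemen 6.12). The `d = 3`
instance of `Markman2025_weilClasses_algebraic_hyperbolicSixfold`, from a REFEREED source. Users take
`(h : Schoen1998_weilClasses_algebraic_hyperbolicSixfold_three)`.
[cite: Schoen1998HodgeWeilAddendum, §§11–13 (pp. 333–335), Lemma 13 and Theorem (p. 329)]
[cite: Schoen1988HodgeWeil, Cor. 3.1 and p. 30] [cite: vanGeemen1994HodgeAV, 5.3–5.4, Thm. 6.12 and 7.3] -/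
def Schoen1998_weilClasses_algebraic_hyperbolicSixfold_three : Prop :=
  ∀ (A : Motives.AbelianVariety ℂ) (φ : A ⟶ A), A.dim = 2 * 3 →
    Motives.IsSmoothProjective (2 * 3) A.X → φ ≫ φ = -((3 : ℕ) • 𝟙 A) →
      ∀ (e : Motives.ProjectiveEmbedding A.X)
        (a : complexBetti (Motives.projectiveSpace e.n ℂ) 2), IsRationalClass a → a ≠ 0 →
        Motives.IsHyperbolicWeilType A φ 3
          (((3 : ℕ) : ℂ) • complexBetti.map e.ι 2 a +
            complexBetti.map φ.hom.hom.hom 2 (complexBetti.map e.ι 2 a)) →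
          ∀ c : complexBetti A.X (2 * 3), IsRationalClass c →
            IsOfHodgeType (2 * 3) A.X (2 * 3) 3 3 c → c ∈ weilClassesOf A φ 3 3 →
              c ∈ algebraicClasses A.X 3

/-! ### Upper bound: the fact is an instance of the summit statement -/

/-- `HodgeConjectureFor` for all smooth projective varieties implies the fact (its instance over hyperbolic abelian
sixfolds with `K = ℚ(√-3)`, restricted to the Weil plane). [cite: Deligne2000, §1] -/
theorem Schoen1998_weilClasses_algebraic_hyperbolicSixfold_three_of_hodgeConjectureFor
    (h : ∀ ⦃n : ℕ⦄ ⦃X : Motives.SchemeOver ℂ⦄, Motives.IsSmoothProjective n X → HodgeConjectureFor n X) :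
    Schoen1998_weilClasses_algebraic_hyperbolicSixfold_three :=
  fun _ _ _ hX _ _ _ _ _ _ c hc h33 _ ↦ (h hX).2 3 c hc h33

/-! ### Relation to the floor -/

/-- Markman's sixfold theorem (all `K`, discriminant `(-1)³`; unrefereed preprint, the tree's
`Markman2025_weilClasses_algebraic_hyperbolicSixfold`) implies Schoen's refereed `ℚ(√-3)` case: it is its instance
`d = 3`. [cite: Markman2025SecantWeil, Thm. 1.5.1 and §1 p. 3] -/
theorem Schoen1998_weilClasses_algebraic_hyperbolicSixfold_three_of_markman
    (h : Markman2025_weilClasses_algebraic_hyperbolicSixfold) :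
    Schoen1998_weilClasses_algebraic_hyperbolicSixfold_three :=
  fun A φ hA hX hφ e a ha ha0 hhyp c hc h33 hW ↦ h 3 (by norm_num) A φ hA hX hφ e a ha ha0 hhyp c hc h33 hW

end HodgeTheory

end Literature.AlgebraicGeometry.HodgeTheory

end
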